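import Literature.NumberTheory.Automorphic.Liu2021.LemD1Item1FirstSentenceAtV2OfNonsplit
import Literature.RepresentationTheory.MoeglinVignerasWaldspurger1987.RankOneThetaLiftNonvanishingProofs
import HarnessLib

/-!
# [Liu2021, Lem. D.1, first sentence + (1)] AS PRINTED holds at every NON-SPLIT place where `V` is ISOTROPIC, every rank `n ≥ 2`,
# on the `U(V)(F_v)`-datum `localLemD1DataAtV₂` — PROVED (theorems only)

Topic `NumberTheory/Automorphic/Liu2021`; namespaces `Literature.NumberTheory.Automorphic.Liu2021.LemD1OfPlace` (§1) and
`Literature.NumberTheory.Automorphic.Liu2021.Def411WeilCarriers` (§2–§3), those of ★ `LemD1DataOfPlace.lean` ∕ ★ `LemD1Item1AtV2OfSplit.lean` ∕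
★ `LemD1Item1FirstSentenceAtV2OfNonsplit.lean`, whose roads this file completes at the isotropic non-split places.  KERNEL: theorems only
(no definition, no named fact, no `sorry`, no instance, no notation).  Cell hodgecm-mathlib, floor 0, fan B rung B-IV (local Weil ∕ Heisenberg ∕
Howe), seat B-p04 (g43); `--supports stmt-HodgeConjecture-24832`.

WHY.  ★ `LemD1_1AsPrinted L` ([Liu2021, Lem. D.1, first sentence + item (1)] AS PRINTED, `LemD1AsPrinted.lean`) is the conjunction
(`IsIrreducibleOrZero L.datum.quot ∧ L.datum.quot.IsAdmissible`) ∧ (`ω(μ, ε, χ) = 0 ↔ E is a field ∧ (V anisotropic ∧ n = 2) ∧ χ̌ = μ²`).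
On the tree's datum `localLemD1DataAtV₂ … v` it is PROVED at every SPLIT place (★ B-p04 (g30) `lemD1_1AsPrinted_localLemD1DataAtV₂_of_not_isField`),
and its FIRST SENTENCE is PROVED at every non-split place (★ B-typ04 `isIrreducibleOrZero_and_isAdmissible_localLemD1DataAtV₂_of_isField`,
[MoeglinVignerasWaldspurger1987, Chap. 3 IV.4]).  This file adds item (1) at every non-split place where the hermitian space `V = (E_vᴺ, J_V)` is
ISOTROPIC: there both sides of the printed equivalence are `False` — the right side because `V` is not anisotropic, the left side because
`ω(μ_v, ε_v, χ_v) ≠ 0` by the PROVED stable-range lemma [MoeglinVignerasWaldspurger1987, Chap. 3 IV.2] ★ `mvw_IV2_rankOne_nonvanishing_of_isotropic_holds`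
(B-p04 (g0), p593652) for the pair `(U(⟨a⟩), U(J_V ⊗ (a)))`.  So after this file the letter [Lem. D.1 (1)] on `localLemD1DataAtV₂` is OPEN ONLY
at the finitely many non-split places where `V_v` is ANISOTROPIC (at `N = 2`: `(d, −t₀t₁)_v = −1`, ★ `not_isIsotropic_standingData_iff_hilbertSymbol_eq_neg_one`,
★ `finite_setOf_not_isIsotropic`) — the ε-dichotomy proper [HarrisKudlaSweet1996, Prop. 5.1 (iii)] + [SunZhu2015, Thm. 1.10] of Liu's printed proof (l. 5245).

* §1 `LemD1OfPlace.isIsotropic_standingData_reindex_kronecker` — GENERIC bookkeeping: if `(E_vᴺ, J)` is isotropic then so is the line-twisted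
  space `(E_vⁿ, reindex e e (J ⊗ₖ J₁))` for every `1 × 1` matrix `J₁` (the witness `x` is re-indexed along `e : Fin N × Fin 1 ≃ Fin n`; the form
  scales by `J₁ 0 0`).
* §2 `Def411WeilCarriers.nontrivial_coinv_omegaLoc_localCenter_of_isField_of_isIsotropic` — the `χ_v`-coinvariants of `ω_v = 𝓢.omegaLoc v` along the
  local centre of `U(J_V ⊗ (a))(F_v)` are NON-ZERO at a non-split place where `(E_vᴺ, J_V)` is isotropic, every `n ≥ 2` (IV.2 at the smooth
  section `𝓢.s v`, isotropy moved by §1); `Def411WeilCarriers.lemD1_1AsPrinted_localLemD1DataAtV₂_of_isField_of_not_isAnisotropic` —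
  `LemD1_1AsPrinted (localLemD1DataAtV₂ … v)` at such a place (first sentence ★, non-vanishing transported to the datum along ★ `quotEquivLocalType₂`
  exactly as in the split file, item (1) `iff_of_false`); `Def411WeilCarriers.lemD1_1AsPrinted_localLemD1DataAtV₂_of_not_isAnisotropic` — ANY place
  where `V_v` is isotropic (split: ★ B-p04 (g30) under its unitarity hypothesis `hL2`; non-split: the previous theorem).
* §3 `Def411WeilCarriers.lemD1_1AsPrinted_localLemD1DataAtV₂_cm_of_forall_smul_eq_of_not_isAnisotropic` — the READING on the rank-2 CM θ-package
  `(λ′, a′, χ)`: binders = those of the letter ★ `LemD1RankTwoCMLetters.LemD1_1AsPrintedNonsplitCM₂` at ONE place `v` + its non-split guard `hv` +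
  the isotropy hypothesis, conclusion LITERALLY the letter's body `LemD1_1AsPrinted (localLemD1DataAtV₂ (Fp L) L … a′ 𝓢_{λ′,a′} … χ v)` at that place.

HONEST SCOPE: nothing of [Liu2021] is asserted; §1–§3 are theorems of the tree over PROVED interface facts (IV.2, IV.4).  The letter
`LemD1_1AsPrintedNonsplitCM₂` itself (all non-split `v`, including the anisotropic ones) is NOT proved here: the vanishing
«`E` field ∧ `V` anisotropic ∧ `χ̌ = μ²` ⇒ `ω(μ, ε, χ) = 0`» and the non-vanishing for `χ̌ ≠ μ²` at an anisotropic plane remain the consumer's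
letter.  HC_CM is proved only modulo the printed citations — the 2 remaining named inputs (hLiu418 = stmt-HodgeConjecture-24832, h413 = 24833) —
until rung 0 closes; this file touches no book.

## References
* [Liu2021] Y. Liu, *Fourier–Jacobi cycles and arithmetic relative trace formula*, Camb. J. Math. 9 (2021) = arXiv:2102.11518, App. D Lemma D.1,
  first sentence + (1) (p. 125, l. 5226–5229); proof l. 5243–5245 (p. 126).
* [MoeglinVignerasWaldspurger1987] C. Mœglin, M.-F. Vignéras, J.-L. Waldspurger, *Correspondances de Howe sur un corps p-adique*, LNM 1291 (1987),
  Chap. 3 IV.2 Lemme (stable range) p. 67; IV.4 Théorème principal 1a), 2a).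
* [HarrisKudlaSweet1996] M. Harris, S. Kudla, W. J. Sweet, *Theta dichotomy for unitary groups*, J. AMS 9 (1996), Prop. 5.1 (iii).
-/

set_option autoImplicit false

noncomputable section

open scoped Matrix Kronecker TensorProduct Classical RestrictedProduct
open NumberField IsDedekindDomain Filter Set
open _root_.MeasureTheory
open Literature.NumberTheory Literature.NumberTheory.Automorphic Literature.NumberTheory.Automorphic.UnitaryGroup
open Literature.NumberTheory.Weil1964 Literature.RepresentationTheory
open Literature.RepresentationTheory.HeisenbergGroup
open Literature.RepresentationTheory.Liu2021 (OscillatorStandingData)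
open Literature.RepresentationTheory.CentralCharacterQuotient (augmentation)
open Literature.RepresentationTheory.MoeglinVignerasWaldspurger1987

/-! ## §1 Isotropy moves from `(E_vᴺ, J)` to the line-twisted space `(E_vⁿ, reindex e e (J ⊗ₖ J₁))` -/

namespace Literature.NumberTheory.Automorphic.Liu2021.LemD1OfPlace

variable {F : Type} (E : Type) [Field F] [NumberField F] [Field E] [NumberField E] [Algebra F E]
variable [Algebra.IsQuadraticExtension F E] (v : HeightOneSpectrum (𝓞 F)) (c : E ≃ₐ[F] E) (N : ℕ) {n : ℕ}
  (e : Fin N × Fin 1 ≃ Fin n) (J : Matrix (Fin N) (Fin N) E) (J₁ : Matrix (Fin 1) (Fin 1) E)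
variable {δ : E} (hcδ : c δ = -δ) (hδ : δ ≠ 0)

/-- **Isotropy is inherited by the line twist `V ⊗ ⟨a⟩`**: if the hermitian space `(E_vᴺ, J ⊗ 1)` of the standing data at `v` has a non-zero
isotropic vector `x`, then `y := x ∘ pr₁ ∘ e⁻¹` is a non-zero isotropic vector of `(E_vⁿ, reindex e e (J ⊗ₖ J₁) ⊗ 1)` — its form value is
`(J₁ 0 0 ⊗ 1) · (x, x) = 0`.  (Needed to feed [MVW, IV.2]'s isotropy hypothesis, stated on the big space `J_V ⊗ (a)` of the pair, from the datum's
«`V` is isotropic».) [cite: Liu2021, App. D Lemma D.1 (1), (4) («V isotropic»)] [cite: MoeglinVignerasWaldspurger1987, Chap. 3 IV.2] -/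
theorem isIsotropic_standingData_reindex_kronecker (hN : 2 ≤ N) (hJh : (J.map c)ᵀ = J) (hJdet : J.det ≠ 0)
    (hn : 2 ≤ n) (hJh' : ((Matrix.reindex e e (J ⊗ₖ J₁)).map c)ᵀ = Matrix.reindex e e (J ⊗ₖ J₁))
    (hJdet' : (Matrix.reindex e e (J ⊗ₖ J₁)).det ≠ 0)
    (hiso : LemD1.IsIsotropic (standingData E v c N J hcδ hδ hN hJh hJdet)) :
    LemD1.IsIsotropic (standingData E v c n (Matrix.reindex e e (J ⊗ₖ J₁)) hcδ hδ hn hJh' hJdet') := by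
  obtain ⟨x, hx0, hx⟩ := hiso
  refine ⟨fun k => x (e.symm k).1, ?_, ?_⟩
  · -- `y ≠ 0`: `x i = y (e (i, 0))`
    intro hy
    apply hx0
    funext i
    have h := congr_fun hy (e (i, 0))
    simpa only [Equiv.symm_apply_apply, Pi.zero_apply] using h
  · -- the form value: re-index both sums along `e`, collapse the `Fin 1` factors
    unfold OscillatorStandingData.form Literature.AlgebraicGeometry.ShimuraVarieties.hermForm at hx ⊢
    rw [standingData_gram, localGram_eq] at hx ⊢
    simp only [dotProduct, Matrix.mulVec, Function.comp_apply, OscillatorStandingData.σ_apply, standingData_conj_apply,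
      Matrix.map_apply, Matrix.reindex_apply, Matrix.submatrix_apply, Matrix.kroneckerMap_apply] at hx ⊢
    -- `Σ_k Σ_l c(x_{k₁}) (J_{k₁ l₁} J₁_{k₂ l₂} ⊗ 1) x_{l₁}` over `k l : Fin n` ↦ over `Fin N × Fin 1` ↦ over `Fin N`
    rw [← e.sum_comp]
    simp_rw [← e.sum_comp (fun l => _)]
    simp only [Equiv.symm_apply_apply, Fintype.sum_prod_type, Finset.univ_unique, Fin.default_eq_zero, Finset.sum_singleton,
      map_mul]
    -- now `Σ_i c(x_i) * Σ_j (φ (J i j) * φ (J₁ 0 0)) * x_j = φ (J₁ 0 0) * Σ_i c(x_i) * Σ_j φ (J i j) * x_j = φ (J₁ 0 0) * 0`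
    have h : ∀ i : Fin N, conjLocal E c v (x i) * ∑ j : Fin N, algebraMap E (LocalRing E v) (J i j) *
        algebraMap E (LocalRing E v) (J₁ 0 0) * x j =
        algebraMap E (LocalRing E v) (J₁ 0 0) * (conjLocal E c v (x i) * ∑ j : Fin N, algebraMap E (LocalRing E v) (J i j) * x j) := by
      intro i
      rw [Finset.mul_sum, Finset.mul_sum, Finset.mul_sum]
      exact Finset.sum_congr rfl fun j _ => by ring
    simp_rw [h]
    rw [← Finset.mul_sum, hx, mul_zero]

end Literature.NumberTheory.Automorphic.Liu2021.LemD1OfPlace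

/-! ## §2 Item (1) at a NON-SPLIT ISOTROPIC place on the `U(V)(F_v)`-datum `localLemD1DataAtV₂`, every rank `n ≥ 2` -/

namespace Literature.NumberTheory.Automorphic.Liu2021.Def411WeilCarriers

open Literature.NumberTheory.GelbartRogawski1991 Literature.NumberTheory.GelbartRogawski1991.UnitaryDualPair
open Literature.NumberTheory.GelbartRogawski1991.UnitaryDualPair.WeilCoinv
open Literature.NumberTheory.GelbartRogawski1991.GRConstruction

section AtV

variable (F E : Type) [Field F] [NumberField F] [Field E] [NumberField E] [Algebra F E]
variable (c : E ≃ₐ[F] E) (N : ℕ) {n : ℕ} (e : Fin N × Fin 1 ≃ Fin n)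
variable (JV : Matrix (Fin N) (Fin N) E) {TV : Matrix (Fin N) (Fin N) F}
variable [Algebra.IsQuadraticExtension F E] {δ : E} (hcδ : c δ = -δ) (hδ : δ ≠ 0) {d : F} (hd : δ * δ = algebraMap F E d)

/-- **[MVW, IV.2] read on the local Weil factor of a splitting family**: at a place `v` NON-SPLIT in `E` where the hermitian space `(E_vᴺ, J_V)`
is ISOTROPIC, every rank `n ≥ 2`, the `χ_v`-coinvariants of `ω_v = 𝓢.omegaLoc v` along the local centre `z ↦ z·1` of `U(J_V ⊗ (a))(F_v)`
(`χ_v = localCharOfCenter … χ v`, unitary and continuous) are NON-ZERO — the PROVED stable-range lemma ★ `mvw_IV2_rankOne_nonvanishing_of_isotropic_holds`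
at the smooth section `𝓢.s v` over `iota` (`𝓢.omegaLoc v = toRep ∘ 𝓢.s v` by `rfl`), its isotropy hypothesis on `J_V ⊗ (a)` supplied by §1.
[cite: MoeglinVignerasWaldspurger1987, Chap. 3 IV.2 Lemme p. 67] [cite: Liu2021, App. D, proof of Lemma D.1 (1), l. 5245] -/
theorem nontrivial_coinv_omegaLoc_localCenter_of_isField_of_isIsotropic (hV : TV.IsSymm) (hVd : IsUnit TV.det)
    (hJV : JV = TV.map (algebraMap F E)) (a : Fˣ)
    (𝓢 : LocalSplitting.FinLocalSplittings F E c n hcδ hδ hd (gram F e TV (TW F a)) (isSymm_gram F e hV (isSymm_TW F a))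
      (reindex_kronecker_eq_gram_map F E e hJV (JW_eq F E a)))
    (hn : 2 ≤ n) (hN : 2 ≤ N) (χ : Chi F E c) (v : HeightOneSpectrum (𝓞 F)) (hf : IsField (LocalRing E v))
    (hiso : LemD1.IsIsotropic (LemD1OfPlace.standingData E v c N JV hcδ hδ hN (transpose_map_conj_JV F E c N JV hV hJV)
      (det_JV_ne_zero F E N JV hVd hJV))) :
    Nontrivial (TwistedCoinv.Coinv
      (show Representation ℂ (localPi E c 1 (JW F E a) v) (SchwartzBruhat (Fin n → v.adicCompletion F)) from
        (𝓢.omegaLoc v).comp (localCenter E c n (Matrix.reindex e e (JV ⊗ₖ JW F E a)) (JW F E a) (JW_apply_ne_zero F E a) v))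
      (localCharOfCenter F E c (JW F E a) (JW_apply_ne_zero F E a) χ.1 v)) := by
  have hiso' : LemD1.IsIsotropic (LemD1OfPlace.standingData E v c n (Matrix.reindex e e (JV ⊗ₖ JW F E a)) hcδ hδ hn
      (reindex_kronecker_JW_hermitian F E c N e JV hV hJV a) (det_reindex_kronecker_JW_ne_zero F E N e JV hVd hJV a)) :=
    LemD1OfPlace.isIsotropic_standingData_reindex_kronecker E v c N e JV (JW F E a) hcδ hδ hN
      (transpose_map_conj_JV F E c N JV hV hJV) (det_JV_ne_zero F E N JV hVd hJV) hn _ _ hiso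
  exact mvw_IV2_rankOne_nonvanishing_of_isotropic_holds F E c n δ hcδ hδ d hd _ _ (isUnit_det_gram F e hVd (isUnit_det_TW F a)) _ _ v
    hf hn (reindex_kronecker_JW_hermitian F E c N e JV hV hJV a) (det_reindex_kronecker_JW_ne_zero F E N e JV hVd hJV a) hiso'
    (𝓢.s v) (𝓢.proj_s v) (𝓢.smooth v) (JW F E a) (JW_apply_ne_zero F E a) _
    (norm_localCharOfCenter F E c (JW F E a) (JW_apply_ne_zero F E a)
      (norm_chi_eq_one F E c (Algebra.IsQuadraticExtension.finrank_eq_two F E) (UnitaryGroup.algEquiv_ne_one_of_apply_eq_neg F E c hcδ hδ) χ) v)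
    (continuous_coe_localCharOfCenter F E c (JW F E a) (JW_apply_ne_zero F E a) χ.2.1 v)

/-- **[Liu2021, Lem. D.1, first sentence + (1)] AS PRINTED at a place `v` NON-SPLIT in `E` where `V_v` is ISOTROPIC, every rank `n ≥ 2`, on the
rank-`≥ 2` datum `localLemD1DataAtV₂ … v` — PROVED.**  Binders token for token those of ★ `isIrreducibleOrZero_and_isAdmissible_localLemD1DataAtV₂_of_isField`
plus `hiso : ¬ (…).IsAnisotropic` (the datum's own «`V` is anisotropic», negated).  First sentence: ★ (B-typ04, [MVW, IV.4] PROVED).  Item (1): both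
sides `False` — `V_v` is not anisotropic; `ω(μ_v, ε_v, χ_v) ≠ 0` by `nontrivial_coinv_omegaLoc_localCenter_of_isField_of_isIsotropic` ([MVW, IV.2]
PROVED) transported to the datum along ★ `quotEquivLocalType₂`.
[cite: Liu2021, App. D Lemma D.1 (1) (p. 125, l. 5226–5229); proof l. 5243–5245 (p. 126)]
[cite: MoeglinVignerasWaldspurger1987, Chap. 3 IV.2 Lemme p. 67; IV.4 Thm principal 1a), 2a)] -/
theorem lemD1_1AsPrinted_localLemD1DataAtV₂_of_isField_of_not_isAnisotropic (hV : TV.IsSymm) (hVd : IsUnit TV.det)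
    (hJV : JV = TV.map (algebraMap F E)) (a : Fˣ)
    (𝓢 : LocalSplitting.FinLocalSplittings F E c n hcδ hδ hd (gram F e TV (TW F a)) (isSymm_gram F e hV (isSymm_TW F a))
      (reindex_kronecker_eq_gram_map F E e hJV (JW_eq F E a)))
    (hn : 2 ≤ n) (μ : ∀ v : HeightOneSpectrum (𝓞 F), (LocalRing E v)ˣ →* ℂˣ) (hμn : ∀ v x, ‖((μ v x : ℂˣ) : ℂ)‖ = 1)
    (hμc : ∀ v, Continuous fun x => ((μ v x : ℂˣ) : ℂ))
    (hμF : ∀ (v : HeightOneSpectrum (𝓞 F)) (t : (v.adicCompletion F)ˣ),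
      μ v (Units.map (algebraMap (v.adicCompletion F) (LocalRing E v)).toMonoidHom t) = 1 ↔
        ∃ x : (LocalRing E v)ˣ, (x : LocalRing E v) * conjLocal E c v x = algebraMap (v.adicCompletion F) (LocalRing E v) t)
    (χ : Chi F E c) (v : HeightOneSpectrum (𝓞 F)) (hf : IsField (LocalRing E v))
    (hiso : ¬ (localLemD1DataAtV₂ F E c N e JV hcδ hδ hd hV hVd hJV a 𝓢 hn μ hμn hμc hμF χ v).IsAnisotropic) :
    LemD1_1AsPrinted (localLemD1DataAtV₂ F E c N e JV hcδ hδ hd hV hVd hJV a 𝓢 hn μ hμn hμc hμF χ v) := by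
  -- the first sentence ([MVW, IV.4] PROVED, ★ B-typ04)
  have h12 := isIrreducibleOrZero_and_isAdmissible_localLemD1DataAtV₂_of_isField F E c N e JV hcδ hδ hd hV hVd hJV a 𝓢 hn μ hμn hμc hμF
    χ v hf
  -- isotropy of `(E_vᴺ, J_V)` in the standing-data currency
  have hiso₀ : LemD1.IsIsotropic (localLemD1DataAtV₂ F E c N e JV hcδ hδ hd hV hVd hJV a 𝓢 hn μ hμn hμc hμF χ v).S :=
    not_not.mp fun h => hiso ((LemD1Data.isAnisotropic_iff_not_isIsotropic _).mpr h)
  -- non-vanishing on the big group ([MVW, IV.2] PROVED), transported to the datum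
  have hnt := nontrivial_coinv_omegaLoc_localCenter_of_isField_of_isIsotropic F E c N e JV hcδ hδ hd hV hVd hJV a 𝓢 hn _ χ v hf hiso₀
  haveI hq : Nontrivial (SchwartzBruhat (Fin n → v.adicCompletion F) ⧸
      augmentation (localLemD1DataAtV₂ F E c N e JV hcδ hδ hd hV hVd hJV a 𝓢 hn μ hμn hμc hμF χ v).omega
        (localLemD1DataAtV₂ F E c N e JV hcδ hδ hd hV hVd hJV a 𝓢 hn μ hμn hμc hμF χ v).S.scalar
        (localLemD1DataAtV₂ F E c N e JV hcδ hδ hd hV hVd hJV a 𝓢 hn μ hμn hμc hμF χ v).chi) :=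
    (quotEquivLocalType₂ F E c N e JV hcδ hδ hd hV hVd hJV a 𝓢 hn μ hμn hμc hμF χ v).toLinearEquiv.toEquiv.nontrivial_congr.2 hnt
  refine ⟨h12, iff_of_false (not_subsingleton _) ?_⟩
  rintro ⟨-, ⟨han, -⟩, -⟩
  exact hiso han

/-- **[Liu2021, Lem. D.1, first sentence + (1)] AS PRINTED at ANY place `v` where `V_v` is ISOTROPIC, every rank `n ≥ 2`, on the datum
`localLemD1DataAtV₂ … v`** — the split case is ★ B-p04 (g30) `lemD1_1AsPrinted_localLemD1DataAtV₂_of_not_isField` (under its unitarity hypothesis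
`hL2`, supplied only when `E_v` is split), the non-split case is `lemD1_1AsPrinted_localLemD1DataAtV₂_of_isField_of_not_isAnisotropic`.
[cite: Liu2021, App. D Lemma D.1 (1) (p. 125, l. 5226–5229); proof l. 5243–5253 (p. 126)]
[cite: MoeglinVignerasWaldspurger1987, Chap. 3 IV.2; IV.4 Thm principal 1a), 2a)] -/
theorem lemD1_1AsPrinted_localLemD1DataAtV₂_of_not_isAnisotropic (hV : TV.IsSymm) (hVd : IsUnit TV.det)
    (hJV : JV = TV.map (algebraMap F E)) (a : Fˣ)
    (𝓢 : LocalSplitting.FinLocalSplittings F E c n hcδ hδ hd (gram F e TV (TW F a)) (isSymm_gram F e hV (isSymm_TW F a))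
      (reindex_kronecker_eq_gram_map F E e hJV (JW_eq F E a)))
    (hn : 2 ≤ n) (μ : ∀ v : HeightOneSpectrum (𝓞 F), (LocalRing E v)ˣ →* ℂˣ) (hμn : ∀ v x, ‖((μ v x : ℂˣ) : ℂ)‖ = 1)
    (hμc : ∀ v, Continuous fun x => ((μ v x : ℂˣ) : ℂ))
    (hμF : ∀ (v : HeightOneSpectrum (𝓞 F)) (t : (v.adicCompletion F)ˣ),
      μ v (Units.map (algebraMap (v.adicCompletion F) (LocalRing E v)).toMonoidHom t) = 1 ↔
        ∃ x : (LocalRing E v)ˣ, (x : LocalRing E v) * conjLocal E c v x = algebraMap (v.adicCompletion F) (LocalRing E v) t)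
    (χ : Chi F E c) (v : HeightOneSpectrum (𝓞 F))
    [MeasurableSpace (v.adicCompletion F)] [BorelSpace (v.adicCompletion F)]
    (μ' : Measure (v.adicCompletion F)) [μ'.IsAddHaarMeasure]
    (hL2 : ¬ IsField (LocalRing E v) → (𝓢.omegaLoc v).IsL2Isometric (Measure.pi fun _ : Fin n => μ'))
    (hiso : ¬ (localLemD1DataAtV₂ F E c N e JV hcδ hδ hd hV hVd hJV a 𝓢 hn μ hμn hμc hμF χ v).IsAnisotropic) :
    LemD1_1AsPrinted (localLemD1DataAtV₂ F E c N e JV hcδ hδ hd hV hVd hJV a 𝓢 hn μ hμn hμc hμF χ v) := by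
  by_cases hf : IsField (LocalRing E v)
  · exact lemD1_1AsPrinted_localLemD1DataAtV₂_of_isField_of_not_isAnisotropic F E c N e JV hcδ hδ hd hV hVd hJV a 𝓢 hn μ hμn hμc hμF
      χ v hf hiso
  · exact lemD1_1AsPrinted_localLemD1DataAtV₂_of_not_isField F E c N e JV hcδ hδ hd hV hVd hJV a 𝓢 hn μ hμn hμc hμF χ v hf μ' (hL2 hf)

end AtV

/-! ## §3 The reading on the rank-2 CM θ-package of the letter ★ `LemD1RankTwoCMLetters.LemD1_1AsPrintedNonsplitCM₂`, at an ISOTROPIC place -/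

section CM

open NumberField.mixedEmbedding NumberField.InfinitePlace
open Literature.NumberTheory.GaloisRepresentations Literature.RepresentationTheory.HarrisKudlaSweet1996
open Literature.NumberTheory.Automorphic.IdeleClassGroup Literature.RepresentationTheory.Liu2021
open Literature.NumberTheory.Automorphic.Liu2021.Def411WeilCarriersDoubling
open Literature.NumberTheory.GelbartRogawski1991.UnitaryDualPair.LocalSplitting

/-- **[Liu2021, Lem. D.1, first sentence + (1)] AS PRINTED on the rank-2 CM θ-package `(λ′, a′, χ)` at a NON-SPLIT finite place `v` of `L⁺` where
the plane `(L_v², diag dV)` is ISOTROPIC — PROVED.**  Binders = those of the letter ★ `LemD1RankTwoCMLetters.LemD1_1AsPrintedNonsplitCM₂` (ED. 2 of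
`LemD1RankTwoCMLetters.lean`) at ONE place `v`, its non-split guard `hv`, and the isotropy hypothesis `hiso : ¬ (…).IsAnisotropic` on the letter's own
datum term; conclusion LITERALLY the letter's body `LemD1_1AsPrinted (localLemD1DataAtV₂ (Fp L) L … a′ 𝓢_{λ′,a′} … (localMu L (toHeckeCharacter L λ′)) … χ v)`
at that place.  `E_v = LocalRing L v` is a field by the contrapositive of ★ `SplitPlace.exists_placesOver_smul_ne_of_not_isField`, then §2.  (At `N = 2`
the isotropy hypothesis reads `(δ², −dV₀dV₁)_v = 1`, ★ `LemD1OfPlace.isIsotropic_standingData_iff_hilbertSymbol_eq_one`; it fails at finitely many `v`,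
★ `LemD1OfPlace.finite_setOf_not_isIsotropic`.)  So the letter `LemD1_1AsPrintedNonsplitCM₂` is now OPEN ONLY at the anisotropic non-split places.
[cite: Liu2021, App. D Lemma D.1 (1) (p. 125, l. 5226–5229); proof l. 5243–5245 (p. 126)]
[cite: MoeglinVignerasWaldspurger1987, Chap. 3 IV.2 Lemme p. 67; IV.4 Thm principal 1a), 2a)] -/
theorem lemD1_1AsPrinted_localLemD1DataAtV₂_cm_of_forall_smul_eq_of_not_isAnisotropic
    (L : Type) [Field L] [NumberField L] [IsCMField L]
      (dV : Fin 2 → L) (hdV : ∀ i, IsCMField.complexConj L (dV i) = dV i) (hdV0 : ∀ i, dV i ≠ 0)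
      {n' : ℕ} (e₁ : Fin 2 × Fin 1 ≃ Fin n')
      (χ : Chi (↥(maximalRealSubfield L)) L (IsCMField.complexConj L)) (a' : (↥(maximalRealSubfield L))ˣ)
      (lam' : Literature.NumberTheory.Automorphic.IdeleClassGroup L →ₜ* Circle) (hlam' : IsConjugateSymplectic L lam')
      (v : HeightOneSpectrum (𝓞 ↥(maximalRealSubfield L)))
    (hv : ∀ w : UnitaryGroup.PlacesOver L v, IsCMField.complexConj L • (w : HeightOneSpectrum (𝓞 L)) = w)
    (hiso : ¬ (localLemD1DataAtV₂ (Fp L) L (IsCMField.complexConj L) 2 e₁ (Matrix.diagonal dV) (complexConj_imagUnit L)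
        (imagUnit_ne_zero L) (imagUnit_mul_self L) (realDiagonal_isSymm L dV hdV) (isUnit_det_realDiagonal L dV hdV hdV0)
        (realDiagonal_map L dV hdV).symm a' (congrW L e₁ dV hdV (lineW L (TW (Fp L) a')) (complexConj_lineW L (TW (Fp L) a')) (realDiagonal_lineW L (TW (Fp L) a')) (diagonal_lineW L (TW (Fp L) a') (JW_eq (Fp L) L a')) (undoubledSplittings L e₁ dV hdV hdV0 (lineW L (TW (Fp L) a')) (complexConj_lineW L (TW (Fp L) a')) (lineW_ne_zero L (TW (Fp L) a') (isUnit_det_TW (Fp L) a')) (toHeckeCharacter L lam') (borelPlaceMeasure L) (cmFinLocalFamily L e₁ dV hdV hdV0 (lineW L (TW (Fp L) a')) (complexConj_lineW L (TW (Fp L) a')) (lineW_ne_zero L (TW (Fp L) a') (isUnit_det_TW (Fp L) a')) (toHeckeCharacter L lam') ((isOscillatorChar_toHeckeCharacter_iff lam').mpr hlam') (borelPlaceMeasure L))) (isSymm_TW (Fp L) a') (JW_eq (Fp L) L a')) (by -- `2 ≤ n'` (§D.1 «rank n ≥ 2»); the assembler's proof argument here is `two_le_of_finTwo_equiv e₁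`
          have h := Fintype.card_congr e₁
          simp only [Fintype.card_prod, Fintype.card_fin, mul_one] at h
          omega)
        (localMu L (toHeckeCharacter L lam')) (fun v x => norm_localMu L (toHeckeCharacter L lam') v (isUnitary_toHeckeCharacter L lam') x)
        (continuous_localMu L (toHeckeCharacter L lam'))
        (fun v t => localMu_toLocalRing_eq_one_iff L (toHeckeCharacter L lam') v ((isOscillatorChar_toHeckeCharacter_iff lam').mpr hlam') t)
        χ v).IsAnisotropic) :
    LemD1_1AsPrinted (localLemD1DataAtV₂ (Fp L) L (IsCMField.complexConj L) 2 e₁ (Matrix.diagonal dV) (complexConj_imagUnit L)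
        (imagUnit_ne_zero L) (imagUnit_mul_self L) (realDiagonal_isSymm L dV hdV) (isUnit_det_realDiagonal L dV hdV hdV0)
        (realDiagonal_map L dV hdV).symm a' (congrW L e₁ dV hdV (lineW L (TW (Fp L) a')) (complexConj_lineW L (TW (Fp L) a')) (realDiagonal_lineW L (TW (Fp L) a')) (diagonal_lineW L (TW (Fp L) a') (JW_eq (Fp L) L a')) (undoubledSplittings L e₁ dV hdV hdV0 (lineW L (TW (Fp L) a')) (complexConj_lineW L (TW (Fp L) a')) (lineW_ne_zero L (TW (Fp L) a') (isUnit_det_TW (Fp L) a')) (toHeckeCharacter L lam') (borelPlaceMeasure L) (cmFinLocalFamily L e₁ dV hdV hdV0 (lineW L (TW (Fp L) a')) (complexConj_lineW L (TW (Fp L) a')) (lineW_ne_zero L (TW (Fp L) a') (isUnit_det_TW (Fp L) a')) (toHeckeCharacter L lam') ((isOscillatorChar_toHeckeCharacter_iff lam').mpr hlam') (borelPlaceMeasure L))) (isSymm_TW (Fp L) a') (JW_eq (Fp L) L a')) (by -- `2 ≤ n'` (§D.1 «rank n ≥ 2»); the assembler's proof argument here is `two_le_of_finTwo_equiv e₁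`
          have h := Fintype.card_congr e₁
          simp only [Fintype.card_prod, Fintype.card_fin, mul_one] at h
          omega)
        (localMu L (toHeckeCharacter L lam')) (fun v x => norm_localMu L (toHeckeCharacter L lam') v (isUnitary_toHeckeCharacter L lam') x)
        (continuous_localMu L (toHeckeCharacter L lam'))
        (fun v t => localMu_toLocalRing_eq_one_iff L (toHeckeCharacter L lam') v ((isOscillatorChar_toHeckeCharacter_iff lam').mpr hlam') t)
        χ v) := by
  have hf : IsField (LocalRing L v) := by
    by_contra h
    obtain ⟨w, hw⟩ := SplitPlace.exists_placesOver_smul_ne_of_not_isField L v (IsCMField.complexConj L)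
      (UnitaryGroup.algEquiv_ne_one_of_apply_eq_neg (Fp L) L (IsCMField.complexConj L) (complexConj_imagUnit L) (imagUnit_ne_zero L)) h
    exact hw (hv w)
  exact lemD1_1AsPrinted_localLemD1DataAtV₂_of_isField_of_not_isAnisotropic (Fp L) L (IsCMField.complexConj L) 2 e₁ (Matrix.diagonal dV)
    (complexConj_imagUnit L) (imagUnit_ne_zero L) (imagUnit_mul_self L) (realDiagonal_isSymm L dV hdV) (isUnit_det_realDiagonal L dV hdV hdV0)
    (realDiagonal_map L dV hdV).symm a' _ _ _ _ _ _ χ v hf hiso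

end CM

end Literature.NumberTheory.Automorphic.Liu2021.Def411WeilCarriers

end
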